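import Summits.Schanuel.Schanuel.Theorems.RootDecomp1KRelLiouvilleCell03

/-!
# RootDecomp1KRelLiouvilleCell — lens 1, generation 34 «RELATIVE-LIOUVILLE CELL of 33364» (RootDecomp1KRelLiouvilleCell.lean fc1db392…, 1985 l) — continuation (RootDecomp1KRelLiouvilleCell04): §4 THE INDUCED MEASURE `induced_logPow_measure_cons_liouvilleNumber` (MvPolyMeasure θ + the pinned scales 2^{N!} of ℓ₂ ⇒ explicit log-power measure for (ℓ₂, θ), exponent d+2) and the class statement `logPowMeasure_cons_liouvilleNumber`

(lens-1 g34 `RootDecomp1KRelLiouvilleCell.lean`, sha256 fc1db392…9176, own farm rc 0 · 0 sorry · axioms std; critic VERDICT STATUS L1658 PORT GO LOW;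
port by census-1 gen 15 in eight parts `RootDecomp1KRelLiouvilleCell01`–`08` — see the PORT NOTE of part 01; `--supports stmt-Schanuel-33364`; rung 0.)
-/

noncomputable section

open Complex IntermediateField Polynomial
open Summit.Schanuel.Schanuel.Theorems.RootDecomp1KHyper
open Summit.Schanuel.Schanuel.Theorems.RootDecomp1KHyper.HyperCell
open Summit.Schanuel.Schanuel.Theorems.RootDecomp1KGeneric

namespace Summit.Schanuel.Schanuel.Theorems.RootDecomp1KRelLiouvilleCell

section InducedMeasure
open LiouvilleNumber
open scoped Nat

/-- **THE INDUCED MEASURE (kernel; the new object of this node).** If `θ = (θ₁,…,θₙ)` has a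
polynomial measure of algebraic independence (`MvPolyMeasure`, class S ∪ T in several variables),
then the extended tuple `(ℓ₂, θ₁, …, θₙ)` has a LOG-POWER measure: for every `d` there are
`C, k` with `|Q(ℓ₂, θ)| ≥ exp(−C (1 + log len Q)^k)` for all non-zero `Q ∈ ℤ[X₀,…,Xₙ]` of total
degree `≤ d` (here `k = d + 2`).  Mechanism: slice `Q = Σ_k G_k(X₁..Xₙ) X₀^k`, evaluate at a
partial sum `s_N = p/2^{N!}` of `ℓ₂` in a WINDOW of `K + 1` consecutive `N` (one of them is not a
root of `μ = Q(·, θ)`), bound `|μ(s_N)|` below by the measure of `θ` applied to the integer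
specialisation `2^{K·N!} Q(s_N, X)` and compare with the factorial tail `|ℓ₂ − s_N| < 2·2^{−(N+1)!}`.

**Explicit exponent** `d + 2` (from ℓ₂'s scales `2^{N!}`: the least window index `N` with
`N! ≳ d·log len Q` has `(N+d)! ≤ N!·(N+d)^d`).  No named fact enters. -/
theorem induced_logPow_measure_cons_liouvilleNumber {n : ℕ} {θ : Fin n → ℂ} (hθ : MvPolyMeasure θ)
    (d : ℕ) : ∃ C : ℝ, 0 < C ∧ ∀ P : MvPolynomial (Fin (n + 1)) ℤ, P ≠ 0 → P.totalDegree ≤ d →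
      Real.exp (-(C * (1 + Real.log ((mvlen P : ℤ) : ℝ)) ^ (d + 2))) ≤
        ‖MvPolynomial.aeval (Fin.cons ((liouvilleNumber 2 : ℝ) : ℂ) θ : Fin (n + 1) → ℂ) P‖ := by
  classical
  obtain ⟨C₀, τ, hC₀, hmeas₀⟩ := hθ d
  -- WLOG the measure constant is ≥ 1
  set Cθ : ℝ := max C₀ 1 with hCθdef
  have hCθ1 : 1 ≤ Cθ := le_max_right _ _
  have hCθ : 0 < Cθ := by linarith
  have hmeas : ∀ P : MvPolynomial (Fin n) ℤ, P ≠ 0 → P.totalDegree ≤ d →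
      1 ≤ Cθ * ((mvlen P : ℤ) : ℝ) ^ τ * ‖MvPolynomial.aeval θ P‖ := by
    intro P hP hdeg
    refine (hmeas₀ P hP hdeg).trans ?_
    have h0 : (0 : ℝ) ≤ ((mvlen P : ℤ) : ℝ) ^ τ := pow_nonneg (by exact_mod_cast mvlen_nonneg P) τ
    exact mul_le_mul_of_nonneg_right (mul_le_mul_of_nonneg_right (le_max_left _ _) h0)
      (norm_nonneg _)
  -- the size of θ and the constants of the node
  set B : ℝ := 1 + ∑ i, ‖θ i‖ with hBdef
  have hsum0 : 0 ≤ ∑ i, ‖θ i‖ := Finset.sum_nonneg fun i _ => norm_nonneg _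
  have hB1 : 1 ≤ B := by rw [hBdef]; linarith
  have hθB : ∀ i, ‖θ i‖ ≤ B := fun i => by
    have := Finset.single_le_sum (f := fun i => ‖θ i‖) (fun i _ => norm_nonneg _)
      (Finset.mem_univ i)
    rw [hBdef]; linarith
  set Γ : ℝ := ((d : ℝ) + 1) * d * 2 ^ d * B ^ d + 1 with hΓdef
  have hΓ0 : (0 : ℝ) ≤ ((d : ℝ) + 1) * d * 2 ^ d * B ^ d := by positivity
  have hΓ1 : 1 ≤ Γ := by rw [hΓdef]; linarith
  have hΓpos : 0 < Γ := by linarith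
  set C₁ : ℝ := Cθ * ((3 : ℝ) ^ d * (d + 1)) ^ τ with hC₁def
  have h3d1 : (1 : ℝ) ≤ (3 : ℝ) ^ d * (d + 1) := by
    have h1 : (1 : ℝ) ≤ 3 ^ d := one_le_pow₀ (by norm_num)
    have h2 : (1 : ℝ) ≤ (d : ℝ) + 1 := by linarith [(Nat.cast_nonneg d : (0 : ℝ) ≤ d)]
    nlinarith
  have hC₁1 : 1 ≤ C₁ := by
    rw [hC₁def]; exact one_le_mul_of_one_le_of_one_le hCθ1 (one_le_pow₀ h3d1)
  have hC₁pos : 0 < C₁ := by linarith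
  set Nd : ℕ := d * (τ + 1) with hNddef
  have h4ΓC₁ : (1 : ℝ) ≤ 4 * Γ * C₁ := one_le_mul_of_one_le_of_one_le (by linarith) hC₁1
  have hlog4 : 0 ≤ Real.log (4 * Γ * C₁) := Real.log_nonneg h4ΓC₁
  set cY : ℝ := Real.log (4 * Γ * C₁) + 1 + τ + 1 with hcYdef
  have hcY1 : 1 ≤ cY := by rw [hcYdef]; linarith [(Nat.cast_nonneg τ : (0 : ℝ) ≤ τ)]
  have hcY0 : 0 ≤ cY := by linarith
  set A₀ : ℝ := (((Nd ! : ℕ) : ℝ) + (2 * cY + 1) ^ 2) * ((Nd : ℝ) + d + 2 * cY + 1) ^ d with hA₀def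
  have hA₀0 : 0 ≤ A₀ := by positivity
  set Cst : ℝ := 2 * C₁ + τ + (d : ℝ) * (τ + 1) * A₀ + 1 with hCstdef
  refine ⟨Cst, by positivity, fun Q hQ hdeg => ?_⟩
  clear_value Cst A₀ cY Nd C₁ Γ B Cθ
  -- notation for Q
  set L : ℝ := ((mvlen Q : ℤ) : ℝ) with hLdef
  have hL1 : 1 ≤ L := by rw [hLdef]; exact_mod_cast one_le_mvlen hQ
  have hL0 : 0 ≤ L := by linarith
  have hlogL0 : 0 ≤ Real.log L := Real.log_nonneg hL1
  set u : ℝ := 1 + Real.log L with hudef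
  have hu1 : 1 ≤ u := by rw [hudef]; linarith
  have hu0 : 0 ≤ u := by linarith
  clear_value L u
  set ℓ : ℝ := liouvilleNumber 2 with hℓdef
  have hℓpos : 0 < ℓ := liouvilleNumber_two_pos
  have hℓlt : ℓ < 3 / 2 := liouvilleNumber_two_lt
  clear_value ℓ
  -- the slices G_k of Q and the one-variable polynomial μ = Q(·, θ)
  set K : ℕ := (MvPolynomial.finSuccEquiv ℤ n Q).natDegree with hKdef
  have hKd : K ≤ d := (natDegree_finSuccEquiv_le_totalDegree Q).trans hdeg
  set G : Fin (K + 1) → MvPolynomial (Fin n) ℤ := fun k => ycoeff Q k with hGdef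
  have hGdeg : ∀ k, (G k).totalDegree ≤ d := fun k => (totalDegree_ycoeff_le Q k).trans hdeg
  have hGlenZ : ∀ k, mvlen (G k) ≤ mvlen Q := fun k => mvlen_ycoeff_le Q k
  have hGlen : ∀ k, ((mvlen (G k) : ℤ) : ℝ) ≤ L := fun k => by
    rw [hLdef]; exact_mod_cast hGlenZ k
  have hGK : G (Fin.last K) ≠ 0 := by
    have hne : MvPolynomial.finSuccEquiv ℤ n Q ≠ 0 := (EmbeddingLike.map_ne_zero_iff).mpr hQ
    have h1 := Polynomial.leadingCoeff_ne_zero.mpr hne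
    rw [Polynomial.leadingCoeff] at h1
    simpa [hGdef, ycoeff, hKdef] using h1
  set μ : ℂ[X] := ∑ k : Fin (K + 1), C (MvPolynomial.aeval θ (G k)) * X ^ (k : ℕ) with hμdef
  have hμeval : ∀ y : ℂ, μ.eval y =
      ∑ k : Fin (K + 1), MvPolynomial.aeval θ (G k) * y ^ (k : ℕ) := by
    intro y
    simp only [hμdef, eval_finsetSum, eval_mul, eval_C, eval_pow, eval_X]
  have hQeval : ∀ y : ℂ, MvPolynomial.aeval (Fin.cons y θ : Fin (n + 1) → ℂ) Q = μ.eval y := by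
    intro y
    rw [hμeval, mvaeval_cons_eq_sum Q θ y le_rfl,
      ← Fin.sum_univ_eq_sum_range (fun k => MvPolynomial.aeval θ (ycoeff Q k) * y ^ k) (K + 1)]
  have hμK : μ.coeff K = MvPolynomial.aeval θ (G (Fin.last K)) := by
    simp only [hμdef, finsetSum_coeff, coeff_C_mul, coeff_X_pow]
    rw [Finset.sum_eq_single (Fin.last K)]
    · simp
    · intro j _ hjk
      have : (K : ℕ) ≠ (j : ℕ) := fun h => hjk (Fin.ext (by simp [h]))
      simp [this]
    · intro h; exact absurd (Finset.mem_univ _) h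
  have hμtop : MvPolynomial.aeval θ (G (Fin.last K)) ≠ 0 := by
    intro h0
    have := hmeas _ hGK (hGdeg _)
    rw [h0, norm_zero, mul_zero] at this
    linarith
  have hμ0 : μ ≠ 0 := fun h => hμtop (by rw [← hμK, h, Polynomial.coeff_zero])
  have hμdeg : μ.natDegree ≤ K := by
    rw [hμdef]
    refine Polynomial.natDegree_sum_le_of_forall_le _ _ fun k _ => ?_
    exact (Polynomial.natDegree_C_mul_X_pow_le _ _).trans (Nat.lt_succ_iff.mp k.2)
  clear_value μ G
  -- sizes of the slices and the tail estimate
  have hGnorm : ∀ k, ‖MvPolynomial.aeval θ (G k)‖ ≤ L * B ^ d := fun k =>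
    (norm_mvaeval_le_mvlen_mul_pow (G k) θ hB1 hθB (hGdeg k)).trans
      (mul_le_mul_of_nonneg_right (hGlen k) (by positivity))
  have htail : ∀ a b : ℝ, |a| ≤ 2 → |b| ≤ 2 →
      ‖μ.eval (a : ℂ) - μ.eval (b : ℂ)‖ ≤ Γ * L * |a - b| := by
    intro a b ha hb
    rw [hμeval, hμeval]
    refine (norm_sum_sub_sum_le hKd _ (by positivity) hGnorm ha hb).trans ?_
    have hLab : 0 ≤ L * |a - b| := by positivity
    calc ((d : ℝ) + 1) * (L * B ^ d) * (d * 2 ^ d) * |a - b|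
        = (((d : ℝ) + 1) * d * 2 ^ d * B ^ d) * (L * |a - b|) := by ring
      _ ≤ Γ * (L * |a - b|) := by
          refine mul_le_mul_of_nonneg_right ?_ hLab
          rw [hΓdef]; linarith
      _ = Γ * L * |a - b| := by ring
  -- the window: Y ≤ 2^{N₀!}, N₀ ≥ N_d
  set Y : ℝ := 4 * Γ * C₁ * L ^ (1 + τ) with hYdef
  have hLpow1 : 1 ≤ L ^ (1 + τ) := one_le_pow₀ hL1
  have hY1 : 1 ≤ Y := by
    rw [hYdef]; exact one_le_mul_of_one_le_of_one_le h4ΓC₁ hLpow1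
  have hYpos : 0 < Y := lt_of_lt_of_le one_pos hY1
  have hlogY : Real.log Y ≤ cY * u := by
    have e1 : Real.log Y = Real.log (4 * Γ * C₁) + (1 + τ) * Real.log L := by
      rw [hYdef, Real.log_mul (by positivity) (by positivity), Real.log_pow]; push_cast; ring
    rw [e1, hcYdef]
    have h1 : (1 + (τ : ℝ)) * Real.log L ≤ (1 + τ) * u := by
      apply mul_le_mul_of_nonneg_left _ (by positivity); rw [hudef]; linarith
    have h2 : Real.log (4 * Γ * C₁) * 1 ≤ Real.log (4 * Γ * C₁) * u :=
      mul_le_mul_of_nonneg_left hu1 hlog4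
    have e2 : (Real.log (4 * Γ * C₁) + 1 + τ + 1) * u =
        Real.log (4 * Γ * C₁) * u + (1 + τ) * u + u := by ring
    rw [e2]
    linarith
  have hlogY0 : 0 ≤ Real.log Y := Real.log_nonneg hY1
  clear_value Y
  obtain ⟨N₀, hN₀d, hN₀Y, hN₀fact, hN₀le⟩ := exists_window_index Y hY1 Nd
  -- one of s_{N₀}, …, s_{N₀+K} is not a root of μ
  have hinj : Function.Injective (fun j : Fin (K + 1) => ((partialSum 2 (N₀ + j) : ℝ) : ℂ)) := by
    intro a b hab
    simp only [Complex.ofReal_inj] at hab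
    have := partialSum_two_strictMono.injective hab
    exact Fin.ext (by omega)
  obtain ⟨j, hj⟩ := exists_eval_ne_zero_of_injective hμ0 hμdeg _ hinj
  set N : ℕ := N₀ + j with hNdef
  have hNN₀ : N₀ ≤ N := Nat.le_add_right _ _
  have hjK : (j : ℕ) ≤ K := Nat.lt_succ_iff.mp j.2
  have hNle : N ≤ N₀ + d := by rw [hNdef]; omega
  have hNdN : Nd ≤ N := hN₀d.trans hNN₀
  clear_value N
  set sN : ℝ := partialSum 2 N with hsNdef
  have hsNpos : 0 < sN := partialSum_two_pos N
  have hsNlt : sN < ℓ := by rw [hℓdef]; exact partialSum_two_lt_liouvilleNumber N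
  have hdist : |ℓ - sN| < 2 / 2 ^ (N + 1)! := by
    rw [hℓdef]; exact abs_liouvilleNumber_two_sub_partialSum N
  -- s_N = p / q with q = 2^{N!}
  obtain ⟨p, hp, hp2⟩ := partialSum_two_eq_nat_div N
  set q : ℕ := 2 ^ N ! with hqdef
  have hq0 : q ≠ 0 := by positivity
  have hqR : (q : ℝ) = 2 ^ N ! := by rw [hqdef]; push_cast; rfl
  have hq1 : (1 : ℝ) ≤ q := by rw [hqR]; exact one_le_pow₀ (by norm_num)
  have hqpos : (0 : ℝ) < q := by linarith
  have hsN : sN = (p : ℝ) / q := by rw [hqR]; exact hp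
  have hp2' : p < 2 * q := by rw [hqdef]; exact hp2
  clear_value sN q
  -- the integer specialisation H = q^K Q(s_N, X)
  set H : MvPolynomial (Fin n) ℤ := mvspecialise G (p : ℤ) q with hHdef
  have hHe : MvPolynomial.aeval θ H = (q : ℂ) ^ K * μ.eval ((sN : ℝ) : ℂ) := by
    rw [hHdef, mvaeval_mvspecialise G (p : ℤ) hq0 θ, hμeval, hsN]
    push_cast
    rfl
  have hqC : (q : ℂ) ≠ 0 := by exact_mod_cast hq0
  have hH0 : H ≠ 0 := by
    intro h0
    have : (q : ℂ) ^ K * μ.eval ((sN : ℝ) : ℂ) = 0 := by rw [← hHe, h0, map_zero]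
    rcases mul_eq_zero.mp this with h | h
    · exact pow_ne_zero K hqC h
    · exact hj h
  have hHdeg : H.totalDegree ≤ d := totalDegree_mvspecialise_le G p q hGdeg
  -- the length of H
  have hpq : |(p : ℤ)| + (q : ℤ) ≤ 3 * q := by
    rw [abs_of_nonneg (by positivity)]
    omega
  have hΛle : ∑ k : Fin (K + 1), mvlen (G k) ≤ ((K + 1 : ℕ) : ℤ) * mvlen Q := by
    calc ∑ k : Fin (K + 1), mvlen (G k) ≤ ∑ _k : Fin (K + 1), mvlen Q :=
          Finset.sum_le_sum fun k _ => hGlenZ k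
      _ = ((K + 1 : ℕ) : ℤ) * mvlen Q := by
          rw [Finset.sum_const, Finset.card_univ, Fintype.card_fin, nsmul_eq_mul]
  have hΛ0 : (0 : ℤ) ≤ ∑ k : Fin (K + 1), mvlen (G k) := Finset.sum_nonneg fun _ _ => mvlen_nonneg _
  have hlenHZ : mvlen H ≤ (3 * (q : ℤ)) ^ K * (((K + 1 : ℕ) : ℤ) * mvlen Q) := by
    calc mvlen H ≤ (|(p : ℤ)| + q) ^ K * ∑ k, mvlen (G k) := mvlen_mvspecialise_le G p q
      _ ≤ (3 * (q : ℤ)) ^ K * ∑ k, mvlen (G k) :=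
          mul_le_mul_of_nonneg_right (pow_le_pow_left₀ (by positivity) hpq K) hΛ0
      _ ≤ (3 * (q : ℤ)) ^ K * (((K + 1 : ℕ) : ℤ) * mvlen Q) :=
          mul_le_mul_of_nonneg_left hΛle (by positivity)
  have hlenH : ((mvlen H : ℤ) : ℝ) ≤ (3 : ℝ) ^ d * (d + 1) * (q : ℝ) ^ d * L := by
    have h1 : ((mvlen H : ℤ) : ℝ) ≤ (((3 * (q : ℤ)) ^ K * (((K + 1 : ℕ) : ℤ) * mvlen Q) : ℤ) : ℝ) := by
      exact_mod_cast hlenHZ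
    refine h1.trans ?_
    push_cast
    rw [← hLdef]
    have hq3 : (1 : ℝ) ≤ 3 * q := by linarith
    have e1 : (3 * (q : ℝ)) ^ K ≤ (3 * (q : ℝ)) ^ d := pow_le_pow_right₀ hq3 hKd
    have e2 : (K : ℝ) + 1 ≤ d + 1 := by exact_mod_cast Nat.succ_le_succ hKd
    have e3 : ((K : ℝ) + 1) * L ≤ ((d : ℝ) + 1) * L := mul_le_mul_of_nonneg_right e2 hL0
    calc (3 * (q : ℝ)) ^ K * (((K : ℝ) + 1) * L) ≤ (3 * (q : ℝ)) ^ d * (((d : ℝ) + 1) * L) :=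
          mul_le_mul e1 e3 (by positivity) (by positivity)
      _ = (3 : ℝ) ^ d * (d + 1) * (q : ℝ) ^ d * L := by rw [mul_pow]; ring
  have hlenH0 : (0 : ℝ) ≤ ((mvlen H : ℤ) : ℝ) := by exact_mod_cast mvlen_nonneg H
  -- the measure of θ at H: X := (C₁ L^τ q^{d(τ+1)})⁻¹ ≤ |μ(s_N)|
  have hmeasH := hmeas H hH0 hHdeg
  have hHnorm : ‖MvPolynomial.aeval θ H‖ = (q : ℝ) ^ K * ‖μ.eval ((sN : ℝ) : ℂ)‖ := by
    rw [hHe, norm_mul, norm_pow, Complex.norm_natCast]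
  clear_value H
  have hlow : 1 ≤ C₁ * L ^ τ * (q : ℝ) ^ (d * (τ + 1)) * ‖μ.eval ((sN : ℝ) : ℂ)‖ := by
    rw [hHnorm] at hmeasH
    have e1 : ((mvlen H : ℤ) : ℝ) ^ τ ≤ ((3 : ℝ) ^ d * (d + 1) * (q : ℝ) ^ d * L) ^ τ :=
      pow_le_pow_left₀ hlenH0 hlenH τ
    have e2 : (q : ℝ) ^ K ≤ (q : ℝ) ^ d := pow_le_pow_right₀ hq1 hKd
    have e3 : Cθ * ((mvlen H : ℤ) : ℝ) ^ τ ≤ Cθ * ((3 : ℝ) ^ d * (d + 1) * (q : ℝ) ^ d * L) ^ τ :=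
      mul_le_mul_of_nonneg_left e1 hCθ.le
    have e4 : (q : ℝ) ^ K * ‖μ.eval ((sN : ℝ) : ℂ)‖ ≤ (q : ℝ) ^ d * ‖μ.eval ((sN : ℝ) : ℂ)‖ :=
      mul_le_mul_of_nonneg_right e2 (norm_nonneg _)
    have e5 : (0 : ℝ) ≤ Cθ * ((3 : ℝ) ^ d * (d + 1) * (q : ℝ) ^ d * L) ^ τ := by positivity
    calc (1 : ℝ) ≤ Cθ * ((mvlen H : ℤ) : ℝ) ^ τ * ((q : ℝ) ^ K * ‖μ.eval ((sN : ℝ) : ℂ)‖) := hmeasH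
      _ ≤ Cθ * ((3 : ℝ) ^ d * (d + 1) * (q : ℝ) ^ d * L) ^ τ *
            ((q : ℝ) ^ d * ‖μ.eval ((sN : ℝ) : ℂ)‖) := mul_le_mul e3 e4 (by positivity) e5
      _ = C₁ * L ^ τ * (q : ℝ) ^ (d * (τ + 1)) * ‖μ.eval ((sN : ℝ) : ℂ)‖ := by
          rw [hC₁def, Nat.mul_succ, pow_add, pow_mul]
          simp only [mul_pow]
          ring
  set X : ℝ := (C₁ * L ^ τ * (q : ℝ) ^ (d * (τ + 1)))⁻¹ with hXdef
  have hDpos : 0 < C₁ * L ^ τ * (q : ℝ) ^ (d * (τ + 1)) := by positivity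
  have hXpos : 0 < X := inv_pos.mpr hDpos
  have hXle : X ≤ ‖μ.eval ((sN : ℝ) : ℂ)‖ := by
    rw [hXdef, inv_le_iff_one_le_mul₀' hDpos]; exact hlow
  clear_value X
  -- the tail: |μ(ℓ) − μ(s_N)| ≤ Γ L |ℓ − s_N| ≤ X / 2, by the window inequality
  have hℓ2 : |ℓ| ≤ 2 := by rw [abs_of_pos hℓpos]; linarith
  have hs2 : |sN| ≤ 2 := by rw [abs_of_pos hsNpos]; linarith
  have htailN := htail ℓ sN hℓ2 hs2
  have hwin_ineq : Y * (q : ℝ) ^ (d * (τ + 1)) ≤ (2 : ℝ) ^ (N + 1)! := by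
    have e1 : (2 : ℝ) ^ (N + 1)! = (q : ℝ) ^ (N + 1) := by
      rw [hqR, ← pow_mul, Nat.factorial_succ, mul_comm]
    rw [e1, pow_succ']
    have hYq : Y ≤ q := by
      rw [hqR]
      exact hN₀Y.trans (pow_le_pow_right₀ (by norm_num) (Nat.factorial_le hNN₀))
    have hqq : (q : ℝ) ^ (d * (τ + 1)) ≤ (q : ℝ) ^ N :=
      pow_le_pow_right₀ hq1 (by rw [← hNddef]; exact hNdN)
    exact mul_le_mul hYq hqq (by positivity) (by positivity)
  have htail2 : Γ * L * |ℓ - sN| ≤ X / 2 := by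
    have hpow_pos : (0 : ℝ) < 2 ^ (N + 1)! := by positivity
    have h1 : Γ * L * |ℓ - sN| ≤ Γ * L * (2 / 2 ^ (N + 1)!) :=
      mul_le_mul_of_nonneg_left hdist.le (by positivity)
    have h2 : (2 : ℝ) / 2 ^ (N + 1)! ≤ 2 / (Y * (q : ℝ) ^ (d * (τ + 1))) :=
      div_le_div_of_nonneg_left (by norm_num) (by positivity) hwin_ineq
    have h3 : Γ * L * (2 / (Y * (q : ℝ) ^ (d * (τ + 1)))) = X / 2 := by
      rw [hXdef, hYdef]
      field_simp
      ring
    calc Γ * L * |ℓ - sN| ≤ Γ * L * (2 / 2 ^ (N + 1)!) := h1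
      _ ≤ Γ * L * (2 / (Y * (q : ℝ) ^ (d * (τ + 1)))) :=
          mul_le_mul_of_nonneg_left h2 (by positivity)
      _ = X / 2 := h3
  -- hence |Q(ℓ₂, θ)| = |μ(ℓ)| ≥ X / 2
  have hfinal : X / 2 ≤ ‖MvPolynomial.aeval (Fin.cons ((ℓ : ℝ) : ℂ) θ : Fin (n + 1) → ℂ) Q‖ := by
    rw [hQeval]
    have h1 := norm_sub_norm_le (μ.eval ((sN : ℝ) : ℂ)) (μ.eval ((ℓ : ℝ) : ℂ))
    rw [norm_sub_rev] at h1
    linarith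
  refine le_trans ?_ hfinal
  -- it remains: exp(−Cst u^{d+2}) ≤ X / 2, i.e. 2 C₁ L^τ q^{d(τ+1)} ≤ exp(Cst u^{d+2})
  have hX2 : X / 2 = (2 * C₁ * L ^ τ * (q : ℝ) ^ (d * (τ + 1)))⁻¹ := by
    rw [hXdef, div_eq_mul_inv, ← mul_inv]
    congr 1
    ring
  rw [hX2, Real.exp_neg]
  refine inv_anti₀ (by positivity) ?_
  have hNfact : ((N ! : ℕ) : ℝ) ≤ A₀ * u ^ (d + 2) := by
    rw [hA₀def]; exact factorial_window_le hNle hN₀fact hN₀le hlogY0 hlogY hcY0 hu1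
  have hqpow : (q : ℝ) ^ (d * (τ + 1)) ≤ Real.exp ((d : ℝ) * (τ + 1) * (N ! : ℕ)) := by
    rw [hqR, ← pow_mul]
    have h2e : (2 : ℝ) ≤ Real.exp 1 := by
      have := Real.add_one_le_exp 1; norm_num at this; linarith
    calc ((2 : ℝ) ^ (N ! * (d * (τ + 1)))) ≤ (Real.exp 1) ^ (N ! * (d * (τ + 1))) :=
          pow_le_pow_left₀ (by norm_num) h2e _
      _ = Real.exp ((d : ℝ) * (τ + 1) * (N ! : ℕ)) := by
          rw [Real.exp_one_pow]; push_cast; ring_nf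
  rw [hCstdef]
  exact two_mul_prod_le_exp hC₁pos (by linarith) (by rw [hudef]; linarith) hu1 (by omega)
    (by positivity) hA₀0 (by positivity) hqpow hNfact

end InducedMeasure

/-- **THE INDUCED MEASURE** as a class statement: `MvPolyMeasure θ ⇒ LogPowMeasure (ℓ₂, θ)`. -/
theorem logPowMeasure_cons_liouvilleNumber {n : ℕ} {θ : Fin n → ℂ} (hθ : MvPolyMeasure θ) :
    LogPowMeasure (Fin.cons ((liouvilleNumber 2 : ℝ) : ℂ) θ : Fin (n + 1) → ℂ) := fun d =>
  let ⟨C, hC, h⟩ := induced_logPow_measure_cons_liouvilleNumber hθ d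
  ⟨C, d + 2, hC, h⟩

end Summit.Schanuel.Schanuel.Theorems.RootDecomp1KRelLiouvilleCell
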